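import Summits.RiemannHypothesis.RiemannHypothesis.Theses.WeilGroundState
import Summits.RiemannHypothesis.RiemannHypothesis.Theorems.WeilGroundStateGroundStatesConvergeToXiEvenWitness
import Summits.RiemannHypothesis.RiemannHypothesis.Theorems.WeilGroundStateGroundStatesConvergeToXiGapQuasimode
import Summits.RiemannHypothesis.RiemannHypothesis.Theorems.WeilGroundStateGroundStatesConvergeToXiFrequentlySimpleEven
import Literature.NumberTheory.LFunctions.WeilGroundState
import Literature.NumberTheory.LFunctions.WeilWindowSimpleEven
import Literature.NumberTheory.LFunctions.WeilGroundStateRealZerosProofs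
import Literature.NumberTheory.LFunctions.WeilSemilocalCompactnessProofs
import Mathlib.Analysis.SpecificLimits.Basic
import HarnessLib

/-!
# RiemannHypothesis / WeilGroundState — the crux plus EVENTUAL UNIQUENESS of the Weil minimiser
proves RH (isolation is automatic, parity is forced)

Route `RiemannHypothesis/WeilGroundState`, crux item stmt-RiemannHypothesis-1527
(`GroundStatesConvergeToXi`), line `Sketch`, continuation lead c4 (helper file, `--supports`;
sharpening of the route's assembly for the planner).

Connes (arXiv:2602.04022, §5/§6.1): the zeros of the transform of the Weil minimiser lie on the
line "modulo a condition of uniqueness of the minimum [one needs to assume that the lowest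
eigenvalue of the quadratic form is simple and even]".  The route encodes this as crux #2
`GroundStateSimpleEven` = `WeilWindowSimpleEven a` at every window (simple + ISOLATED + EVEN,
variationally).  This file reduces the hypothesis, given crux #3, to bare UNIQUENESS UP TO PHASE
of the ground state at all large windows:

* `exists_gap_orthogonal_of_unique` — **uniqueness ⇒ isolation (RH-free)**: if at the window
  `a > 0` any two ground states `v, w` have `|⟨v, w⟩| = 1`, then every ground state `u` has a gap
  `δ > 0` on its orthogonal complement: normalised window tests `g ⊥ u` have `Re Q(g) ≥ ε(a) + δ`.
  Proof: otherwise normalised tests `gₙ ⊥ u` with `Re Q(gₙ) → ε(a)` exist; by the COMPACTNESS of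
  the form embedding (Connes–Consani–Moscovici 2025 Thm 3.6, PROVED in the tree:
  `ConnesConsaniMoscovici2025_thm_3_6_holds`) a subsequence converges in `L²` to some `w`, which
  is a ground state by definition, with `⟨w, u⟩ = lim ⟨gₙ, u⟩ = 0` — contradicting `|⟨w, u⟩| = 1`.
* `weilWindowSimpleEven_of_unique_of_even` — uniqueness + an EVEN ground state `u` give
  `WeilWindowSimpleEven a` (with `φ = u`; odd tests are orthogonal to `u`).
* `norm_integral_mul_conj_eq_one_of_windowSimpleEven` — conversely `WeilWindowSimpleEven a`
  implies uniqueness up to phase (`ConnesVanSuijlekom.gap_inequality` along a minimising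
  sequence), so the new hypothesis is implied by the route's.
* `riemannHypothesis_of_cruxWitness_of_eventually_unique`,
  `riemannHypothesis_of_groundStatesConvergeToXi_of_eventually_unique` — **crux #3 + "for all
  large windows the ground state is unique up to phase" ⇒ RH**: pass to an even witness
  (`exists_even_cruxWitness`), get `WeilWindowSimpleEven` at its windows, and apply c3's
  frequently-simple-even theorem (Connes–van Suijlekom Thm 6.1 + Hurwitz, both in the tree).

So, for the route: ISOLATION of the bottom is automatic (compactness, proved), EVENNESS is forced
by crux #3 (`…EvenWitness`), and what remains of crux #2 is exactly Connes' "uniqueness of the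
minimum", needed only at all large windows.  RH-free; no new definitions.
-/

set_option linter.dupNamespace false

noncomputable section

open MeasureTheory Complex Filter Set
open scoped Real Topology ComplexConjugate

namespace Summit.RiemannHypothesis.RiemannHypothesis.Theorems.GroundStatesConvergeToXi

open Literature.NumberTheory.LFunctions

/-! ### Uniqueness of the ground state gives a gap on its orthogonal complement -/

/-- `∫ u ḡ = conj ∫ ū g`. [folklore] -/
theorem integral_mul_conj_eq_conj (u g : ℝ → ℂ) :
    ∫ t, u t * conj (g t) = conj (∫ t, conj (u t) * g t) := by
  rw [← integral_conj]
  congr 1 with t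
  simp [mul_comm]

/-- **Uniqueness up to phase ⇒ spectral gap on the orthogonal complement (RH-free).**  At a
window `a > 0` where any two ground states `v, w` satisfy `‖∫ v w̄‖ = 1`, every ground state `u`
admits `δ > 0` with `Re Q(g) ≥ ε(a) + δ` for all `L²`-normalised window test functions `g` with
`∫ ū g = 0`.  (Compactness of the form embedding, `ConnesConsaniMoscovici2025_thm_3_6_holds`: a
normalised sequence `gₙ ⊥ u` with `Re Q(gₙ) → ε(a)` would have an `L²`-convergent subsequence,
whose limit is a ground state orthogonal to `u`.) [folklore] -/
theorem exists_gap_orthogonal_of_unique {a : ℝ} (ha : 0 < a)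
    (huniq : ∀ v w : ℝ → ℂ, IsWeilGroundState a v → IsWeilGroundState a w →
      ‖∫ t, v t * conj (w t)‖ = 1)
    {u : ℝ → ℂ} (hu : IsWeilGroundState a u) :
    ∃ δ : ℝ, 0 < δ ∧ ∀ g : ℝ → ℂ, IsWeilTest g → tsupport g ⊆ Icc (-a) a →
      ∫ t, ‖g t‖ ^ 2 = (1 : ℝ) → ∫ t, conj (u t) * g t = 0 →
        weilGroundEnergy a + δ ≤ (weilQuadratic g).re := by
  by_contra hcon
  push Not at hcon
  choose g hg hgs hg1 hgo hgQ using fun n : ℕ ↦ hcon (1 / ((n : ℝ) + 1)) (by positivity)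
  -- `Re Q(gₙ) → ε(a)`
  have hlow : ∀ n, weilGroundEnergy a ≤ (weilQuadratic (g n)).re := fun n ↦ by
    have := weilGroundEnergy_mul_integral_norm_sq_le (hg n) (hgs n)
    rw [hg1 n, mul_one] at this
    exact this
  have hQ : Tendsto (fun n ↦ (weilQuadratic (g n)).re) atTop (𝓝 (weilGroundEnergy a)) := by
    have hup : Tendsto (fun n : ℕ ↦ weilGroundEnergy a + 1 / ((n : ℝ) + 1)) atTop
        (𝓝 (weilGroundEnergy a)) := by
      simpa using tendsto_const_nhds.add
        (tendsto_one_div_add_atTop_nhds_zero_nat : Tendsto (fun n : ℕ ↦ 1 / ((n : ℝ) + 1)) _ _)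
    exact tendsto_of_tendsto_of_tendsto_of_le_of_le tendsto_const_nhds hup hlow
      fun n ↦ (hgQ n).le
  -- compactness: a subsequence converges in `L²` to a ground state `w`
  obtain ⟨w, hw, φ, hφ, hconv⟩ := ConnesConsaniMoscovici2025_thm_3_6_holds a ha g
    (fun n ↦ ⟨hg n, hgs n, hg1 n⟩) hQ.bddAbove_range
  have hwGS : IsWeilGroundState a w :=
    ⟨hw, fun n ↦ g (φ n), fun n ↦ ⟨hg _, hgs _, hg1 _⟩, hQ.comp hφ.tendsto_atTop, hconv⟩
  -- `⟨u, g_{φ n}⟩ = 0` passes to the limit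
  have hpair : Tendsto (fun n ↦ ∫ t, u t * conj (g (φ n) t)) atTop
      (𝓝 (∫ t, u t * conj (w t))) :=
    ConnesVanSuijlekom.tendsto_integral_mul_conj hu.memLp hw
      (fun n ↦ ConnesVanSuijlekom.isWeilTest_memLp (hg _)) hconv
  have hzero : ∀ n, ∫ t, u t * conj (g (φ n) t) = 0 := fun n ↦ by
    rw [integral_mul_conj_eq_conj u (g (φ n)), hgo (φ n), map_zero]
  have hlim0 : ∫ t, u t * conj (w t) = 0 :=
    tendsto_nhds_unique hpair (by simp only [hzero]; exact tendsto_const_nhds)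
  have h1 := huniq u w hu hwGS
  rw [hlim0, norm_zero] at h1
  exact zero_ne_one h1

/-- **Uniqueness + an even ground state ⇒ `WeilWindowSimpleEven`.**  With `φ = u` the even
ground state: odd window tests are orthogonal to `u` (`ū g` is odd, `weilMellin_half_eq_zero_of_odd`)
and the even clause is the orthogonality hypothesis, so the gap of
`exists_gap_orthogonal_of_unique` is the variational "simple, isolated, even bottom". [folklore] -/
theorem weilWindowSimpleEven_of_unique_of_even {a : ℝ} (ha : 0 < a)
    (huniq : ∀ v w : ℝ → ℂ, IsWeilGroundState a v → IsWeilGroundState a w →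
      ‖∫ t, v t * conj (w t)‖ = 1)
    {u : ℝ → ℂ} (hu : IsWeilGroundState a u) (heven : ∀ t, u (-t) = u t) :
    WeilWindowSimpleEven a := by
  obtain ⟨δ, hδ, hgap⟩ := exists_gap_orthogonal_of_unique ha huniq hu
  refine ⟨u, δ, hδ, fun g hg hgs hg1 hpar ↦ hgap g hg hgs hg1 ?_⟩
  rcases hpar with hodd | ⟨-, horth⟩
  · -- `t ↦ ū(t) g(t)` is odd, so its integral (`= weilMellin _ (1/2)`) vanishes
    have hodd' : ∀ t, (fun t ↦ conj (u t) * g t) (-t) = -(fun t ↦ conj (u t) * g t) t :=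
      fun t ↦ by simp only [heven t, hodd t, mul_neg]
    have h := weilMellin_half_eq_zero_of_odd (u := fun t ↦ conj (u t) * g t) hodd'
    unfold weilMellin at h
    simpa using h
  · exact horth

/-! ### The route's clause implies uniqueness -/

/-- **`WeilWindowSimpleEven a` ⇒ the ground state is unique up to phase**: for ground states
`u, w` at `a`, `‖∫ w ū‖ = 1` (the gap inequality `δ(‖g‖² − |⟨g,u⟩|²) ≤ Re Q(g) − ε‖g‖²` of
Connes–van Suijlekom along a minimising sequence of `w`, and Cauchy–Schwarz).  So the
uniqueness hypothesis below is implied by the route's crux #2. [folklore] -/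
theorem norm_integral_mul_conj_eq_one_of_windowSimpleEven {a : ℝ} {u w : ℝ → ℂ}
    (hW : WeilWindowSimpleEven a) (hu : IsWeilGroundState a u) (hw : IsWeilGroundState a w) :
    ‖∫ t, w t * conj (u t)‖ = 1 := by
  obtain ⟨δ, hδ, hgap⟩ := ConnesVanSuijlekom.gap_inequality hW hu
  obtain ⟨hwm, p, hp, hpQ, hpL⟩ := hw
  -- `⟨p_n, u⟩ → ⟨w, u⟩`
  have hpair : Tendsto (fun n ↦ ∫ t, p n t * conj (u t)) atTop (𝓝 (∫ t, w t * conj (u t))) := by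
    have h := ConnesVanSuijlekom.tendsto_integral_mul_conj hu.memLp hwm
      (fun n ↦ ConnesVanSuijlekom.isWeilTest_memLp (hp n).1) hpL
    have h2 := (Complex.continuous_conj.tendsto _).comp h
    have e1 : (fun n ↦ ∫ t, p n t * conj (u t)) =
        (fun z ↦ conj z) ∘ fun n ↦ ∫ t, u t * conj (p n t) := by
      funext n
      simp only [Function.comp_apply]
      rw [integral_mul_conj_eq_conj (p n) u]
      congr 1
      congr 1 with t
      rw [mul_comm]
    have e2 : ∫ t, w t * conj (u t) = conj (∫ t, u t * conj (w t)) := by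
      rw [integral_mul_conj_eq_conj w u]
      congr 1
      congr 1 with t
      rw [mul_comm]
    rw [e1, e2]
    exact h2
  -- the gap inequality along `p_n`: `δ (1 - |⟨p_n,u⟩|²) ≤ Re Q(p_n) - ε`
  have hineq : ∀ n, δ * (1 - ‖∫ t, p n t * conj (u t)‖ ^ 2) ≤
      (weilQuadratic (p n)).re - weilGroundEnergy a := fun n ↦ by
    have := hgap (p n) (hp n).1 (hp n).2.1
    rw [(hp n).2.2, mul_one] at this
    exact this
  have hl : Tendsto (fun n ↦ δ * (1 - ‖∫ t, p n t * conj (u t)‖ ^ 2)) atTop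
      (𝓝 (δ * (1 - ‖∫ t, w t * conj (u t)‖ ^ 2))) :=
    tendsto_const_nhds.mul (tendsto_const_nhds.sub (hpair.norm.pow 2))
  have hr : Tendsto (fun n ↦ (weilQuadratic (p n)).re - weilGroundEnergy a) atTop (𝓝 0) := by
    simpa using hpQ.sub_const (weilGroundEnergy a)
  have hle : δ * (1 - ‖∫ t, w t * conj (u t)‖ ^ 2) ≤ 0 := le_of_tendsto_of_tendsto' hl hr hineq
  have hge1 : 1 ≤ ‖∫ t, w t * conj (u t)‖ ^ 2 := by nlinarith
  -- Cauchy–Schwarz: `|⟨w,u⟩| ≤ ‖w‖‖u‖ = 1`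
  have hCS : ‖∫ t, w t * conj (u t)‖ ≤ 1 := by
    have hwGS : IsWeilGroundState a w := ⟨hwm, p, hp, hpQ, hpL⟩
    have h := norm_integral_mul_le_sqrt_mul_sqrt hwm (ConnesVanSuijlekom.memLp_conj hu.memLp)
    rw [ConnesVanSuijlekom.integral_norm_sq_conj, hu.integral_norm_sq, hwGS.integral_norm_sq,
      Real.sqrt_one, mul_one] at h
    exact h
  nlinarith [norm_nonneg (∫ t, w t * conj (u t))]

/-- Hence `∀ᶠ a, WeilWindowSimpleEven a` implies eventual uniqueness up to phase. [folklore] -/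
theorem eventually_unique_of_eventually_windowSimpleEven
    (hW : ∀ᶠ a in atTop, WeilWindowSimpleEven a) :
    ∀ᶠ a in atTop, ∀ v w : ℝ → ℂ, IsWeilGroundState a v → IsWeilGroundState a w →
      ‖∫ t, v t * conj (w t)‖ = 1 :=
  hW.mono fun _ ha _ _ hv hw ↦ norm_integral_mul_conj_eq_one_of_windowSimpleEven ha hw hv

/-! ### The crux plus eventual uniqueness proves RH -/

/-- **Crux witness + eventual uniqueness of the minimiser ⇒ RH.**  Let `(a_k, u_k, c_k)` be a
crux-shaped witness and suppose that for all large windows `a` the ground state at `a` is unique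
up to phase (`‖∫ v w̄‖ = 1` for all ground states `v, w` at `a`).  Then RH: pass to an even
witness (`exists_even_cruxWitness`); at its windows uniqueness + evenness give
`WeilWindowSimpleEven` (`weilWindowSimpleEven_of_unique_of_even`, isolation coming from the
compactness theorem), and `riemannHypothesis_of_cruxWitness_frequently_windowSimpleEven`
(Connes–van Suijlekom + Hurwitz) concludes. [folklore] -/
theorem riemannHypothesis_of_cruxWitness_of_eventually_unique {a : ℕ → ℝ} {u : ℕ → ℝ → ℂ}
    {c : ℕ → ℂ} (ha : Tendsto a atTop atTop) (hu : ∀ k, IsWeilGroundState (a k) (u k))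
    (hlim : TendstoLocallyUniformlyOn (fun k s ↦ c k * weilMellin (u k) s) riemannXi atTop
      {s : ℂ | 0 < s.re ∧ s.re < 1})
    (huniq : ∀ᶠ a in atTop, ∀ v w : ℝ → ℂ, IsWeilGroundState a v → IsWeilGroundState a w →
      ‖∫ t, v t * conj (w t)‖ = 1) :
    RiemannHypothesis := by
  obtain ⟨a', v, c', ha', hc', hv, hev, hlim'⟩ := exists_even_cruxWitness ha hu hlim
  have hW : ∀ᶠ k in atTop, WeilWindowSimpleEven (a' k) := by
    filter_upwards [ha'.eventually huniq] with k hk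
    exact weilWindowSimpleEven_of_unique_of_even (hv k).pos hk (hv k) (hev k)
  exact riemannHypothesis_of_cruxWitness_frequently_windowSimpleEven hv
    (Eventually.of_forall hc') hlim' hW.frequently

/-- **Crux #3 + eventual uniqueness of the Weil minimiser ⇒ RH** (`GroundStatesConvergeToXi`
form): the route's crux #2 (`WeilWindowSimpleEven` at every window: simple, isolated and even
bottom) may be replaced by "for all large windows the ground state is unique up to phase" —
isolation is automatic (compactness) and evenness is forced by crux #3. [folklore] -/
theorem riemannHypothesis_of_groundStatesConvergeToXi_of_eventually_unique
    (hcrux : Summit.RiemannHypothesis.RiemannHypothesis.Theses.WeilGroundState.GroundStatesConvergeToXi)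
    (huniq : ∀ᶠ a in atTop, ∀ v w : ℝ → ℂ, IsWeilGroundState a v → IsWeilGroundState a w →
      ‖∫ t, v t * conj (w t)‖ = 1) :
    RiemannHypothesis := by
  obtain ⟨a, u, c, ha, hk, hlim⟩ := hcrux
  exact riemannHypothesis_of_cruxWitness_of_eventually_unique ha
    (fun k ↦ ⟨(hk k).2.2.1, (hk k).2.2.2⟩) hlim huniq

end Summit.RiemannHypothesis.RiemannHypothesis.Theorems.GroundStatesConvergeToXi

end
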